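import Summits.BirchSwinnertonDyer.BirchSwinnertonDyer.Theorems.RamifiedHeegnerPairRamifiedPairUpperBoundRankOneMember
import Summits.BirchSwinnertonDyer.BirchSwinnertonDyer.Theorems.WildThreeRankOneBSDpOfGlobalDivisibilityStepL
import Summits.BirchSwinnertonDyer.Rank1Residual.Additive.PotSupersingularClasses
import HarnessLib

/-!
# Route `RamifiedHeegnerPair`, crux X2 `RamifiedPairUpperBound` (stmt-BirchSwinnertonDyer-23192), skeleton v4 —
# the OPEN CORE `stub_leafRankOneUpper` with NO image row: global divisibility of the derived Heegner points
# over a SPLIT Heegner field + Matar–Nekovář 2019 (irreducible image) + the twist's rank-zero lower half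

HONEST FRAMING. Theorems only; helper file (`--supports stmt-BirchSwinnertonDyer-23192 --as helper`); nothing is
booked, no item is closed, BSD is not proved for any curve; CONDITIONAL on every displayed input. The companion
file `…RankOneMemberGlobalDivisibility.lean` fed the Kolyvagin-side socket of the open core from global
divisibility on the 3-adic-TOWER rows (McCallum 1991 Cor. 5.6 needs `ρ_{E,3^n}` onto). Here the tower binder is
DROPPED: the structure-theorem input is Matar–Nekovář 2019 Thm. 0.7 read through §0.11 (named fact
`MatarNekovar2019.thm07_padicValNat_card_sha_primary_add_le_of_globalDivisibility_of_irreducible`: `p ≠ 2`,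
`ρ̄_{E,p}` IRREDUCIBLE, non-CM, `d_K ∉ {−3, −4}`; hypothesis), and on the Gss2 leaf `E[3]` is AUTOMATICALLY
irreducible (`(G) ∧ ss` is empty on X3: `not_subGss_of_classX3`), so the binders of the result are EXACTLY those
of `stub_leafRankOneUpper` (`¬ HasCM`, `Addv W 3`, `SubGss W 3`, `r_an = 1`) plus ONE split Heegner datum:

* `upper_of_globalDivisibility_of_irreducible` — the cell's receptacle `SchneiderFree.Exact.upper_of_global
  Divisibility_of_surj` with its mod-`p` surjectivity binder weakened to `¬ HasCM ∧ ρ̄_{E,p}` irreducible (the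
  only two consequences of `surj(p)` its proof uses); generic odd `p`; same kernel steps.
* `classX4_three_of_addv_of_subGss` — `Addv W 3 → SubGss W 3 → ClassX4 W 3` (so `E[3]` irreducible).
* `leafRankOneUpper_three_of_globalDivisibility_of_twistLower` — THE OPEN CORE AT `W`, NO IMAGE ROW: for
  non-CM `W` additive of class `(G) ∧ ss` at `3` with `r_an(W) = 1`, ONE split Heegner datum with odd `d_{K′}` and
  `L(W^{(d_{K′})},1) ≠ 0`: global `3^{s′}`-divisibility of the derived Heegner points to depth
  `ord₃ ∏_ℓ c_ℓ(W) + v₃(c)` (research, displayed) + MN19 Thm 0.7 (named) + `Typed.MissingLowerBoundAt Wd 3` for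
  the rank-ZERO twist (Gss2 again) + print ⟹ `Typed.MissingUpperBoundAt W 3`.
* `jointUpperBoundAt_rankOne_of_globalDivisibility_of_twistLower_of_prop48_noTower` — plus Perrin-Riou 2003
  Prop. 4.8 for the good supersingular partner (`surj(9)` for `V` only) ⟹ X2's conclusion at `(W, V, d)`.

Habitat (lead's audit X2-ENGINE-AUDIT.md §3): ALL 355 residual rank-one Gss2 classes (257 onto + 98 normaliser
image), the research input being idle on the 9 tam-free onto classes. Lead prover bsd-line-rhp-p2 g2, 2026-08-28.

References: [cite: MatarNekovar2019, Thm. 0.7 (p. 456) and §0.11 (p. 457)] [cite: McCallumLMS1991, §5 Cor. 5.6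
(p. 310), Lemma 5.1 (p. 303)] [cite: Jetchev2008, Conj. 1.3, Cor. 1.5 (p. 812)] [cite: GrossZagier1986, Thm.
I.(6.3), I.(7.3)] [cite: PerrinRiou2003, Prop. 4.8 (p. 162)] [cite: Miller2011LMS, Def. 1.1].
-/

-- D-0017: single-problem summit, so `Summit.BirchSwinnertonDyer.BirchSwinnertonDyer.…` repeats a namespace BY DESIGN.
set_option linter.dupNamespace false
set_option autoImplicit false

noncomputable section

open scoped Classical

open WeierstrassCurve NumberField IsDedekindDomain Field Literature.NumberTheory.EllipticCurves
  Literature.NumberTheory.EllipticCurves.ModularForms Literature.NumberTheory.EllipticCurves.Rank1Residual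
  Literature.NumberTheory.EllipticCurves.Rank1Residual.Typed Literature.NumberTheory.EllipticCurves.KrizLi2019
  Summit.BirchSwinnertonDyer.Rank1Residual Summit.BirchSwinnertonDyer.Rank1Residual.Additive
  Summit.BirchSwinnertonDyer.Rank1Residual.X11b Summit.BirchSwinnertonDyer.Rank1Residual.X11b.Three
  Summit.BirchSwinnertonDyer.BirchSwinnertonDyer.Theorems.SchneiderFree

namespace Summit.BirchSwinnertonDyer.BirchSwinnertonDyer.Theorems.RamifiedPairUpperBound

/-! ## §1 The receptacle under irreducibility (tower-free, surjectivity-free) -/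

/-- **Global `p^{s′}`-divisibility of the derived Heegner points to depth `ord_p ∏_ℓ c_ℓ(E) + s` ⟹ co-STEP L
at slack `s`, under `ρ̄_{E,p}` IRREDUCIBLE and non-CM only** (the cell's `SchneiderFree.Exact.upper_of_
globalDivisibility_of_surj` with its `surj(p)` binder replaced by the two consequences its proof uses). For
`W/ℚ` globally minimal, non-CM, `p` odd with `E[p]` irreducible, `K` imaginary quadratic Heegner for `N_E` with
`d_K ∉ {−3, −4}`, a datum `(Dt, H, ι)` with Heegner point `P` of infinite order: IF every derived point `P_n`
(square-free `n` of Kolyvagin primes of index `≥ s′`) is `p^{s′}`-divisible for all `s′ ≤ ord_p ∏_ℓ c_ℓ(E) + s`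
(`hglob`, displayed research input) and Matar–Nekovář 2019 Thm. 0.7/§0.11 holds (`hMN`, named fact), THEN
`IndexUpperBoundLeAt W p K P s`. Kernel steps as in the cell's receptacle (Kolyvagin: rank one, `Ш(E/K)` finite;
`E(K)[p] = 0` from irreducibility; the conductor-`1` datum; `p^{M₀} ∥ P`; `ord_p [E(K):ℤP] = M₀`).
[cite: MatarNekovar2019, Thm. 0.7 (p. 456) and §0.11 (p. 457)]
[cite: McCallumLMS1991, §5 Cor. 5.6 (p. 310) and Lemma 5.1 (p. 303)] [cite: Jetchev2008, Conj. 1.3 and (1) (p. 812)] -/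
theorem upper_of_globalDivisibility_of_irreducible
    (hKo : ∀ (N : ℕ) [NeZero N] (W : WeierstrassCurve ℚ) (K : Type) [Field K] [NumberField K],
      kolyvagin N W K)
    (hMN : MatarNekovar2019.thm07_padicValNat_card_sha_primary_add_le_of_globalDivisibility_of_irreducible)
    (W : WeierstrassCurve ℚ) [W.IsElliptic] [W.IsGloballyMinimal] [NeZero (W.conductorNorm ℤ)]
    (p : ℕ) [Fact p.Prime] (hp2 : p ≠ 2) (hCM : ¬ W.HasCM) (hirr : W.HasIrreducibleModPGaloisRep p)
    (K : Type) [Field K] [NumberField K] (hK : IsImaginaryQuadratic K)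
    (h3 : NumberField.discr K ≠ -3) (h4 : NumberField.discr K ≠ -4)
    (hHH : SatisfiesHeegnerHypothesis (W.conductorNorm ℤ) K)
    (Dt : ModularParametrizationData W (W.conductorNorm ℤ))
    (H : HeegnerDatum (W.conductorNorm ℤ) (NumberField.discr K)) (ι : K →+* ℂ)
    (P : (W.baseChange K).toAffine.Point)
    (hP : WeierstrassCurve.Affine.Point.map ι.toRatAlgHom P = heegnerPointComplex Dt H)
    (hnt : ¬ IsOfFinAddOrder P) {s : ℕ}
    (hglob : ∀ (s' : ℕ), s' ≤ padicValNat p W.tamagawaProduct + s →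
      ∀ (n : ℕ) (d : KolyvaginHeegnerData Dt H.β ι n), Squarefree n →
        (∀ ℓ ∈ n.primeFactors, Zhang2014.IsKolyvaginPrime (W.conductorNorm ℤ) W K p ℓ ∧
          s' ≤ Zhang2014.kolyvaginIndex W p ℓ) → Koly.PDiv d p s') :
    Upper.IndexUpperBoundLeAt W p K P s := by
  have hp : p.Prime := Fact.out
  obtain ⟨hrank, hfin⟩ := hKo (W.conductorNorm ℤ) W K hK hHH ⟨Dt, H, ι, hP⟩ hnt
  haveI : Finite (W.baseChange K).sha := hfin
  have hbot := torsionBy_eq_bot_of_isImaginaryQuadratic_of_hasIrreducibleModPGaloisRep W K hK hp hirr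
  have hiv : ∀ x : (W.baseChange K).toAffine.Point, p • x = 0 → x = 0 := fun x hx ↦ by
    have hmem : x ∈ AddSubgroup.torsionBy (W.baseChange K).toAffine.Point ((p : ℕ) : ℤ) := by
      rw [mem_torsionBy_iff, natCast_zsmul]
      exact hx
    rw [hbot] at hmem
    exact hmem
  obtain ⟨d₁⟩ := exists_kolyvaginHeegnerData_one
    (phi_heegnerTau_mem_singularModuliField_holds (W.conductorNorm ℤ) W K) hK Dt H.β ι H.dvd_sq_sub
  have hPd : d₁.toGeomPoints d₁.derivedPoint = toGeomPoints (W.baseChange K) P :=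
    KolyvaginBottom.toGeomPoints_derivedPoint_one_eq
      (heegnerPointOfConductor_one_galoisConj_holds (W.conductorNorm ℤ) W K) hK hHH hP d₁ rfl
  haveI : Module.Finite ℤ (W.baseChange K).toAffine.Point := (W.baseChange K).module_finite_point_holds
  obtain ⟨M₀, x₀, hx₀, hmax⟩ := exists_pow_smul_eq_and_forall_ne hnt (p := p) hp.two_le
  have hdiv : ∃ Q : (W.baseChange K).toAffine.Point, ((p ^ M₀ : ℕ) : ℤ) • Q = P :=
    ⟨x₀, by rw [natCast_zsmul]; exact hx₀⟩
  have hndiv : ¬ ∃ Q : (W.baseChange K).toAffine.Point, ((p ^ (M₀ + 1) : ℕ) : ℤ) • Q = P := by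
    rintro ⟨Q, hQ⟩
    exact hmax Q (by rw [← natCast_zsmul]; exact hQ)
  have hle : padicValNat p (Nat.card (AddCommGroup.primaryComponent (W.baseChange K).sha p)) +
      2 * (padicValNat p W.tamagawaProduct + s) ≤ 2 * M₀ :=
    hMN W hCM K hK h3 h4 hHH p hp2 hirr Dt H.β ι d₁ P hPd hnt M₀ hdiv hndiv
      (padicValNat p W.tamagawaProduct + s) (fun s' hs' n d hn hℓ ↦ hglob s' hs' n d hn hℓ)
  have hsha : padicValNat p (W.baseChange K).shaOrder =
      padicValNat p (Nat.card (AddCommGroup.primaryComponent (W.baseChange K).sha p)) :=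
    Koly.padicValNat_shaOrder_eq (W.baseChange K) p
  haveI : Finite (AddCommGroup.torsion (W.baseChange K).toAffine.Point) :=
    WeierstrassCurve.finite_torsion_point (W := W.baseChange K)
  obtain ⟨c, Q, hcQ, hcker⟩ := RankOne.exists_coord_of_mordellWeilRank_eq_one (W.baseChange K) hrank
  have hidx : padicValNat p (AddSubgroup.zmultiples P).index = M₀ :=
    Koly.padicValNat_index_zmultiples_eq_of_divisibility c Q hcQ hcker hiv P hdiv hndiv
  unfold Upper.IndexUpperBoundLeAt
  rw [hidx, hsha]
  omega

/-! ## §2 The Gss2 leaf has irreducible `E[3]` -/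

/-- **`(G) ∧ ss` at `3` lies in class X4** (`E[3]` irreducible): at the odd prime `3` the additive locus is
`X3 ∪ X4` (`classX3_or_classX4_iff_addv`) and `(G) ∧ ss` is empty on X3 (`not_subGss_of_classX3`). [folklore] -/
theorem classX4_three_of_addv_of_subGss (W : WeierstrassCurve ℚ) [W.IsElliptic] [W.IsGloballyMinimal]
    (hadd : Addv W 3) (hsub : SubGss W 3) : ClassX4 W 3 := by
  rcases (classX3_or_classX4_iff_addv W 3 (by norm_num)).mpr hadd with hX3 | hX4
  · exact absurd hsub (not_subGss_of_classX3 W 3 (by norm_num) hX3)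
  · exact hX4

/-! ## §3 The open core at `W`, no image row -/

/-- **`stub_leafRankOneUpper` AT `W`, NO IMAGE ROW: global divisibility + MN19 + the twist's rank-zero lower
half + print.** Data: `W/ℚ` globally minimal, NON-CM, additive of class `(G) ∧ ss` at `3` (so `E[3]` irreducible),
`r_an(W) = 1`; ONE Heegner datum at level `N_E` over an imaginary quadratic `K′` with ODD `d_{K′}` and the
classical Heegner hypothesis (so `3` splits, `d_{K′} < −4`), `L(W^{(d_{K′})},1) ≠ 0`, `P = y_{K′}`, a globally
minimal model `Wd` of the twist. NAMED FACTS (hypotheses): `hGZ`, `hKo`, `hGZK`, `hmod`, `hGZ73`, Matar–Nekovář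
Thm 0.7/§0.11 `hMN`. RESEARCH INPUT `hglob` (Jetchev's Σ-form at an additive `3`, to depth
`ord₃ ∏_ℓ c_ℓ(W) + v₃(c)`). TYPED INPUT `hlow : Typed.MissingLowerBoundAt Wd 3` (the rank-ZERO Gss2 twist's lower
half). OUTPUT: `Typed.MissingUpperBoundAt W 3`. [cite: MatarNekovar2019, Thm. 0.7 (p. 456) and §0.11 (p. 457)]
[cite: Jetchev2008, Conj. 1.3 and Cor. 1.5 (p. 812)] [cite: GrossZagier1986, Thm. I.(6.3) and (7.3)]
[cite: Miller2011LMS, Def. 1.1] -/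
theorem leafRankOneUpper_three_of_globalDivisibility_of_twistLower
    (hGZ : ∀ (N : ℕ) [NeZero N] (W : WeierstrassCurve ℚ) (K : Type) [Field K] [NumberField K],
      gross_zagier N W K)
    (hKo : ∀ (N : ℕ) [NeZero N] (W : WeierstrassCurve ℚ) (K : Type) [Field K] [NumberField K],
      kolyvagin N W K)
    (hGZK : rank_eq_analyticRank_of_analyticRank_le_one) (hmod : hasEntireLFunction_rat)
    (hGZ73 : GrossZagier1986_thm_I_7_3)
    (hMN : MatarNekovar2019.thm07_padicValNat_card_sha_primary_add_le_of_globalDivisibility_of_irreducible)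
    (W : WeierstrassCurve ℚ) [W.IsElliptic] [W.IsGloballyMinimal] [NeZero (W.conductorNorm ℤ)]
    (hCM : ¬ W.HasCM) (hadd : Addv W 3) (hsub : SubGss W 3) (hr : W.analyticRank = 1)
    (K : Type) [Field K] [NumberField K]
    (Dt : ModularParametrizationData W (W.conductorNorm ℤ))
    (H : HeegnerDatum (W.conductorNorm ℤ) (NumberField.discr K)) (ι : K →+* ℂ)
    (P : (W.baseChange K).toAffine.Point) (Wd : WeierstrassCurve ℚ) [Wd.IsElliptic] [Wd.IsGloballyMinimal]
    (hK : IsImaginaryQuadratic K) (hodd : Odd (NumberField.discr K))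
    (hHH : SatisfiesHeegnerHypothesis (W.conductorNorm ℤ) K)
    (hLd : (W.quadraticTwist (NumberField.discr K : ℚ)).entireLFunction 1 ≠ 0)
    (hP : WeierstrassCurve.Affine.Point.map ι.toRatAlgHom P = heegnerPointComplex Dt H)
    (hC : ∃ C : WeierstrassCurve.VariableChange ℚ, C • W.quadraticTwist (NumberField.discr K : ℚ) = Wd)
    (hglob : ∀ (s' : ℕ), s' ≤ padicValNat 3 W.tamagawaProduct + padicValNat 3 Dt.c.natAbs →
      ∀ (n : ℕ) (d : KolyvaginHeegnerData Dt H.β ι n), Squarefree n →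
        (∀ ℓ ∈ n.primeFactors, Zhang2014.IsKolyvaginPrime (W.conductorNorm ℤ) W K 3 ℓ ∧
          s' ≤ Zhang2014.kolyvaginIndex W 3 ℓ) → Koly.PDiv d 3 s')
    (hlow : MissingLowerBoundAt Wd 3) :
    MissingUpperBoundAt W 3 := by
  have hirr : W.HasIrreducibleModPGaloisRep 3 := (classX4_three_of_addv_of_subGss W hadd hsub).2.2
  -- `3 ∣ N_E` splits in `K`: `d_K ≠ -3`; `d_K` odd: `d_K ≠ -4`; hence `d_K < -4`
  have h3N : 3 ∣ W.conductorNorm ℤ :=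
    (W.dvd_conductorNorm_iff_not_hasGoodReductionAtPrime 3).mpr (not_good_of_addv W 3 hadd)
  have h3 : NumberField.discr K ≠ -3 := by
    intro h
    exact (X11b.Three.not_dvd_discr_and_not_dvd_torsionOrder_of_heegner hK hHH (by decide) h3N).1
      (h ▸ ⟨-1, by norm_num⟩)
  have h4 : NumberField.discr K ≠ -4 := by
    intro h
    rw [h] at hodd
    exact (Int.not_odd_iff_even.mpr ⟨-2, by norm_num⟩) hodd
  have hd4 : NumberField.discr K < -4 := by
    haveI : IsTotallyComplex K := hK.2
    have hneg : NumberField.discr K < 0 := WeierstrassCurve.discr_neg_of_finrank_eq_two K hK.1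
    have hmod4 := Literature.NumberTheory.QuadraticFields.Quadratic.discr_emod_four (K := K) hK.1
    rcases hodd with ⟨k, hk⟩
    omega
  -- the Heegner point is non-torsion (Gross–Zagier)
  have hL0 : W.entireLFunction 1 = 0 := entireLFunction_one_eq_zero_of_analyticRank_eq_one hr
  obtain ⟨-, hderiv⟩ := leadingLCoeff_eq_deriv_of_analyticRank_eq_one hr
  have hLK : LDerivEK W K ≠ 0 := by
    rw [lDerivEK_eq_deriv_mul W K hmod hL0]; exact mul_ne_zero hderiv hLd
  have hnt : ¬ IsOfFinAddOrder P :=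
    (lDerivEK_ne_zero_iff_not_isOfFinAddOrder W (W.conductorNorm ℤ) K (hGZ _ W K) hK hHH
      ⟨Dt, H, ι, hP⟩).mp hLK
  -- the socket at slack `v₃(c)` from global divisibility under irreducibility (§1), then p606327 §2
  have hup : Upper.IndexUpperBoundLeAt W 3 K P (padicValNat 3 Dt.c.natAbs) :=
    upper_of_globalDivisibility_of_irreducible hKo hMN W 3 (by decide) hCM hirr K hK h3 h4 hHH Dt H ι P hP
      hnt hglob
  exact missingUpperBoundAt_three_of_rankOne_addv_of_upperSocket_of_twistLower hGZ hKo hGZK hmod hGZ73 W hadd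
    hr (W.conductorNorm ℤ) K Dt H ι P Wd rfl hK hodd hd4 hHH hLd hP hC hup hlow

/-- **X2's conclusion at `(W, V, d)`, orientation (1, 0), no image row on `W`.** As above, plus the good
supersingular rank-zero partner `V` (`r_an(W) + r_an(V) = 1`, `surj(9)` for `V`) by Perrin-Riou 2003 Prop. 4.8:
`JointUpperBoundAt W V 3`. [cite: MatarNekovar2019, Thm. 0.7 (p. 456)] [cite: Jetchev2008, Conj. 1.3 (p. 812)]
[cite: PerrinRiou2003, Prop. 4.8 (p. 162)] [cite: Miller2011LMS, Def. 1.1] -/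
theorem jointUpperBoundAt_rankOne_of_globalDivisibility_of_twistLower_of_prop48_noTower
    (hGZ : ∀ (N : ℕ) [NeZero N] (W : WeierstrassCurve ℚ) (K : Type) [Field K] [NumberField K],
      gross_zagier N W K)
    (hKo : ∀ (N : ℕ) [NeZero N] (W : WeierstrassCurve ℚ) (K : Type) [Field K] [NumberField K],
      kolyvagin N W K)
    (hGZK : rank_eq_analyticRank_of_analyticRank_le_one) (hmod : hasEntireLFunction_rat)
    (hGZ73 : GrossZagier1986_thm_I_7_3)
    (hMN : MatarNekovar2019.thm07_padicValNat_card_sha_primary_add_le_of_globalDivisibility_of_irreducible)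
    (hPR : PerrinRiou2003.prop48_padicValRat_bsd_rank_zero_le)
    (W : WeierstrassCurve ℚ) [W.IsElliptic] [W.IsGloballyMinimal] [NeZero (W.conductorNorm ℤ)]
    (V : WeierstrassCurve ℚ) [V.IsElliptic] [V.IsGloballyMinimal]
    (hCM : ¬ W.HasCM) (hadd : Addv W 3) (hsub : SubGss W 3) (hss : GoodSS V 3)
    (hsum : W.analyticRank + V.analyticRank = 1) (hr : W.analyticRank = 1)
    (h9 : V.HasSurjectiveModNGaloisRep 9)
    (K : Type) [Field K] [NumberField K]
    (Dt : ModularParametrizationData W (W.conductorNorm ℤ))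
    (H : HeegnerDatum (W.conductorNorm ℤ) (NumberField.discr K)) (ι : K →+* ℂ)
    (P : (W.baseChange K).toAffine.Point) (Wd : WeierstrassCurve ℚ) [Wd.IsElliptic] [Wd.IsGloballyMinimal]
    (hK : IsImaginaryQuadratic K) (hodd : Odd (NumberField.discr K))
    (hHH : SatisfiesHeegnerHypothesis (W.conductorNorm ℤ) K)
    (hLd : (W.quadraticTwist (NumberField.discr K : ℚ)).entireLFunction 1 ≠ 0)
    (hP : WeierstrassCurve.Affine.Point.map ι.toRatAlgHom P = heegnerPointComplex Dt H)
    (hC : ∃ C : WeierstrassCurve.VariableChange ℚ, C • W.quadraticTwist (NumberField.discr K : ℚ) = Wd)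
    (hglob : ∀ (s' : ℕ), s' ≤ padicValNat 3 W.tamagawaProduct + padicValNat 3 Dt.c.natAbs →
      ∀ (n : ℕ) (d : KolyvaginHeegnerData Dt H.β ι n), Squarefree n →
        (∀ ℓ ∈ n.primeFactors, Zhang2014.IsKolyvaginPrime (W.conductorNorm ℤ) W K 3 ℓ ∧
          s' ≤ Zhang2014.kolyvaginIndex W 3 ℓ) → Koly.PDiv d 3 s')
    (hlow : MissingLowerBoundAt Wd 3) :
    Upper.JointUpperBoundAt W V 3 :=
  jointUpperBoundAt_of_analyticRank_eq_one_of_upperW_of_prop48 hPR hGZK hmod W V hss hsum hr h9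
    (leafRankOneUpper_three_of_globalDivisibility_of_twistLower hGZ hKo hGZK hmod hGZ73 hMN W hCM hadd hsub hr
      K Dt H ι P Wd hK hodd hHH hLd hP hC hglob hlow)

end Summit.BirchSwinnertonDyer.BirchSwinnertonDyer.Theorems.RamifiedPairUpperBound

end
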